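import Literature.Claims.NS.Camlin2025

/-!
# C81 `Camlin2025` — refuter kernel facts (D-0090 NS-CLAIMS; refuter-8)

Over the typed skeleton `Literature.Claims.NS.Camlin2025` (typist-1, p470491; SJPBE 1(2) (2025) 012 +
Lean artefact `proof1.lean`, pinned in `pub/ns-claims/sources/Camlin2025/`):

* `not_Lemma211Step3` — Lemma 2.11 proof Step 3 (pinned PDF p.8, printed p.6: «(14) becomes
  dy/dt ≤ C_s y^{3/2} − ν c_P y … a differential Gronwall argument yields, for every T > 0,
  sup_{[0,T]} ‖u_N‖_{H^s} ≤ C(s,T,‖u°‖_{H^s}) independent of N»), typed at the scalar (F15) grain with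
  refuter-8's pre-registered text verbatim, is FALSE: explicit Riccati family. `not_Lemma211Step3Le` — the
  `y(0) ≤ y₀` form the skeleton's composition consumes (`lemma211Hs_of_steps`) falls with it
  (`lemma211Step3_of_le`).
* `not_lemma211Step3_sq` — the referee's charitable re-typing R#a (honest exponent `y²` in (14)) does not
  rescue Step 3.
* `Artefact.not_bkmImpliesRegularity` — in the artefact column, the type of `axiom BKM_implies_regularity`
  (proof1.lean l.121–124) read as a statement is false over the artefact's own definitions: its hypothesis
  `BKM_Finite` holds for every curve (`Artefact.bkmFinite_all`), so it asserts `SmoothSpacetime u` for every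
  `u`, and `u(x,t) := |t|` is not `C^ω` in `t`. (The skeleton's `Artefact.clayB_of_definitions` records the
  complementary fact: the artefact's Clay-B statement follows from its definitions with no axiom at all.)

WHAT THIS IS NOT: not a claim about NS regularity or blow-up; not a claim about any author beyond the typed locator.
-/

set_option linter.dupNamespace false

noncomputable section

namespace Summit.NavierStokesRegularity.NavierStokesRegularity.Theorems.Camlin2025

open Literature.Claims.NS.Camlin2025

/-- The Riccati profile `t ↦ 16 / (1 − a t)²`. -/
noncomputable def prof (a : ℝ) (t : ℝ) : ℝ := 16 / (1 - a * t) ^ 2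

/-- Derivative of the Riccati profile: `(16/(1 − a t)²)′ = 32 a/(1 − a t)³`. -/
theorem prof_hasDerivAt (a t : ℝ) (h : 1 - a * t ≠ 0) :
    HasDerivAt (prof a) (32 * a / (1 - a * t) ^ 3) t := by
  have h1 : HasDerivAt (fun t : ℝ => 1 - a * t) (-a) t := by
    simpa using ((hasDerivAt_id t).const_mul a).const_sub 1
  have h2 : HasDerivAt (fun t : ℝ => (1 - a * t) * (1 - a * t))
      (-a * (1 - a * t) + (1 - a * t) * -a) t := h1.mul h1
  have h3 := (hasDerivAt_const t (16:ℝ)).div h2 (mul_ne_zero h h)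
  have hfun : prof a = fun t => 16 / ((1 - a * t) * (1 - a * t)) := by
    funext s; simp only [prof, pow_two]
  rw [hfun]
  refine h3.congr_deriv ?_
  field_simp
  ring

/-- `(v²)^{3/2} = v³` for `v ≥ 0`. -/
theorem sq_rpow_three_halves (v : ℝ) (hv : 0 ≤ v) : (v ^ 2) ^ ((3:ℝ) / 2) = v ^ 3 := by
  rw [show v ^ 2 = v ^ (2:ℝ) by norm_cast, ← Real.rpow_mul hv]
  norm_num

/-- **Lemma 2.11 Step 3 (p.8 of the pinned PDF; printed p.6) is false as an inference on scalar functions**: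
at `C_s = ν = c_P = 1`, `y₀ = 16`, `T = 1` no bound `C` serves every admissible `y` — the Riccati family
`y_a(t) = 16/(1 − a t)²`, `a = n/(n+1)`, satisfies `y_a(0) = 16`, `y_a ≥ 0`, `y_a′ ≤ y_a^{3/2} − y_a` on `[0,1]`
and `y_a(1) = 16 (n+1)²`. («differential Gronwall … for every T > 0» does not follow from (14): the
comparison ODE `z′ = C_s z^{3/2} − ν c_P z` blows up in finite time from large data.) -/
theorem not_Lemma211Step3 : ¬ Literature.Claims.NS.Camlin2025.Lemma211Step3 := by
  intro h
  obtain ⟨C, hC⟩ := h 1 1 1 16 one_pos one_pos one_pos (by norm_num) 1 one_pos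
  -- choose n with 16 (n+1)² > C and set a = n/(n+1)
  obtain ⟨n, hn⟩ := exists_nat_gt C
  set a : ℝ := (n : ℝ) / (n + 1) with ha
  have hn0 : (0 : ℝ) < n + 1 := by positivity
  have ha0 : 0 ≤ a := by positivity
  have ha1 : a < 1 := by rw [ha, div_lt_one hn0]; linarith
  have hpos : ∀ t ∈ Set.Icc (0:ℝ) 1, 0 < 1 - a * t := by
    intro t ht
    have : a * t ≤ a * 1 := mul_le_mul_of_nonneg_left ht.2 ha0
    linarith
  have key := hC (prof a) (by simp [prof]) (fun t ht => by unfold prof; positivity) ?_ 1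
    ⟨zero_le_one, le_rfl⟩
  · -- value at t = 1 is 16 (n+1)² > C
    have h1a : 1 - a * 1 = 1 / (n + 1) := by rw [ha]; field_simp; ring
    unfold prof at key
    rw [h1a] at key
    have : (16 : ℝ) / (1 / (n + 1)) ^ 2 = 16 * (n + 1) ^ 2 := by field_simp
    rw [this] at key
    nlinarith
  · intro t ht
    have hne : 1 - a * t ≠ 0 := (hpos t ht).ne'
    have hd := prof_hasDerivAt a t hne
    refine ⟨hd.differentiableAt, ?_⟩
    rw [hd.deriv]
    -- 32 a/(1-at)^3 ≤ (16/(1-at)^2)^{3/2} - 16/(1-at)^2, with u = 1/(1-at) ≥ 1 and a < 1 ≤ 3/2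
    have hu : 1 ≤ 1 / (1 - a * t) := by
      rw [le_div_iff₀ (hpos t ht)]
      have : 0 ≤ a * t := mul_nonneg ha0 ht.1
      linarith
    have hprof : prof a t = (4 / (1 - a * t)) ^ 2 := by unfold prof; field_simp; norm_num
    rw [hprof, sq_rpow_three_halves _ (by have := hpos t ht; positivity)]
    set u : ℝ := 1 / (1 - a * t) with hu_def
    have hu3 : 32 * a / (1 - a * t) ^ 3 = 32 * a * u ^ 3 := by
      rw [hu_def]; field_simp
    have h4 : (4 / (1 - a * t)) = 4 * u := by rw [hu_def]; field_simp
    rw [hu3, h4]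
    have hu0 : 0 ≤ u := le_trans zero_le_one hu
    nlinarith [mul_nonneg (mul_nonneg hu0 hu0) (sub_nonneg.mpr hu), ha1, hu0, mul_nonneg hu0 hu0,
      mul_nonneg (mul_nonneg hu0 hu0) hu0, mul_nonneg (mul_nonneg (mul_nonneg hu0 hu0) hu0) (sub_nonneg.mpr ha1.le)]



/-- **Step 3′ (`y(0) ≤ y₀`, the form consumed by `lemma211Hs_of_steps`) is false** — it implies Step 3
(`lemma211Step3_of_le`). -/
theorem not_Lemma211Step3Le : ¬ Literature.Claims.NS.Camlin2025.Lemma211Step3Le :=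
  fun h => not_Lemma211Step3 (lemma211Step3_of_le h)

/-- The profile `t ↦ 4 / (1 − a t)`. -/
noncomputable def prof1 (a : ℝ) (t : ℝ) : ℝ := 4 / (1 - a * t)

/-- Derivative of the profile: `(4/(1 − a t))′ = 4 a/(1 − a t)²`. -/
theorem prof1_hasDerivAt (a t : ℝ) (h : 1 - a * t ≠ 0) :
    HasDerivAt (prof1 a) (4 * a / (1 - a * t) ^ 2) t := by
  have h1 : HasDerivAt (fun t : ℝ => 1 - a * t) (-a) t := by
    simpa using ((hasDerivAt_id t).const_mul a).const_sub 1
  have h3 := (hasDerivAt_const t (4:ℝ)).div h1 h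
  refine h3.congr_deriv ?_
  field_simp
  ring

/-- **Referee's charitable re-typing R#a** (ns-claims-ref-3, `claims/Camlin2025/RETYPE.md` §2: inequality (14)
with the honest exponent `y²`, `y′ ≤ C_s y² − ν c_P y`) — the «for every T» conclusion of Step 3 is STILL
false: `C_s = ν = c_P = 1`, `y₀ = 4`, `T = 1`, family `y_a(t) = 4/(1 − a t)`, `a = n/(n+1)`, `y_a(1) = 4(n+1)`.
Stated inline (same binder shape as `Lemma211Step3` with `(y t) ^ 2`). -/
theorem not_lemma211Step3_sq :
    ¬ (∀ (Cs ν cP y₀ : ℝ), 0 < Cs → 0 < ν → 0 < cP → 0 ≤ y₀ → ∀ T : ℝ, 0 < T →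
      ∃ C : ℝ, ∀ y : ℝ → ℝ, y 0 = y₀ → (∀ t ∈ Set.Icc (0:ℝ) T, 0 ≤ y t) →
        (∀ t ∈ Set.Icc (0:ℝ) T, DifferentiableAt ℝ y t ∧
          deriv y t ≤ Cs * (y t) ^ 2 - ν * cP * y t) →
        ∀ t ∈ Set.Icc (0:ℝ) T, y t ≤ C) := by
  intro h
  obtain ⟨C, hC⟩ := h 1 1 1 4 one_pos one_pos one_pos (by norm_num) 1 one_pos
  obtain ⟨n, hn⟩ := exists_nat_gt C
  set a : ℝ := (n : ℝ) / (n + 1) with ha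
  have hn0 : (0 : ℝ) < n + 1 := by positivity
  have ha0 : 0 ≤ a := by positivity
  have ha1 : a < 1 := by rw [ha, div_lt_one hn0]; linarith
  have hpos : ∀ t ∈ Set.Icc (0:ℝ) 1, 0 < 1 - a * t := by
    intro t ht
    have : a * t ≤ a * 1 := mul_le_mul_of_nonneg_left ht.2 ha0
    linarith
  have hnn : ∀ t ∈ Set.Icc (0:ℝ) 1, 0 ≤ prof1 a t := fun t ht => by
    unfold prof1; exact div_nonneg (by norm_num) (hpos t ht).le
  have key := hC (prof1 a) (by simp [prof1]) hnn ?_ 1 ⟨zero_le_one, le_rfl⟩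
  · have h1a : 1 - a * 1 = 1 / (n + 1) := by rw [ha]; field_simp; ring
    unfold prof1 at key
    rw [h1a] at key
    have : (4 : ℝ) / (1 / (n + 1)) = 4 * (n + 1) := by field_simp
    rw [this] at key
    nlinarith
  · intro t ht
    have hne : 1 - a * t ≠ 0 := (hpos t ht).ne'
    have hd := prof1_hasDerivAt a t hne
    refine ⟨hd.differentiableAt, ?_⟩
    rw [hd.deriv]
    unfold prof1
    have hu : 1 ≤ 1 / (1 - a * t) := by
      rw [le_div_iff₀ (hpos t ht)]
      have : 0 ≤ a * t := mul_nonneg ha0 ht.1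
      linarith
    set u : ℝ := 1 / (1 - a * t) with hu_def
    have e1 : 4 * a / (1 - a * t) ^ 2 = 4 * a * u ^ 2 := by rw [hu_def]; field_simp
    have e2 : (4 : ℝ) / (1 - a * t) = 4 * u := by rw [hu_def]; field_simp
    rw [e1, e2]
    have hu0 : 0 ≤ u := le_trans zero_le_one hu
    nlinarith [mul_nonneg hu0 (sub_nonneg.mpr hu), mul_nonneg (mul_nonneg hu0 hu0) (sub_nonneg.mpr ha1.le)]


/-! ## Artefact column (proof1.lean) -/

/-- **The artefact's `axiom BKM_implies_regularity` (l.121–124), as a statement over the artefact's own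
definitions, is false**: `BKM_Finite` holds for every curve (`Artefact.bkmFinite_all`), so the axiom asserts
`SmoothSpacetime u` for EVERY `u : 𝕋³ → ℝ → Fin 3 → ℝ`; for `u x t j := |t|` the clause
`smoothInTime (fun t => u x t j) = ContDiff ℝ ⊤ |·|` fails (`|·|` is not differentiable at `0`). -/
theorem Artefact.not_bkmImpliesRegularity : ¬ Literature.Claims.NS.Camlin2025.Artefact.BKMImpliesRegularity := by
  intro h
  have hsm := h (fun _ t _ => |t|) 1 (Artefact.bkmFinite_all _ _)
  have habs : ContDiff ℝ ⊤ (fun t : ℝ => |t|) := hsm.2 (fun _ => 0) 0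
  have hdiff : DifferentiableAt ℝ (fun t : ℝ => |t|) 0 := (habs.differentiable (by simp)).differentiableAt
  exact not_differentiableAt_abs_zero hdiff

end Summit.NavierStokesRegularity.NavierStokesRegularity.Theorems.Camlin2025

end
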